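import Summits.KontsevichZagierPeriods.Zeta5Search.LaiSweepShard

/-!
# `κ₃` sweep certificate — shard file 074 of 127 (shards 518–524 of 889)

HONEST FRAMING. Systematic search; no irrationality claim unless certified. This file only checks,
by `decide +kernel`, shards 518–524 of the order-cell sweep of the `κ₃` point `(74, 2180, 444; δ74)`
(engine `LaiSweepEngine`, soundness `LaiSweepJump/Free/Eval/Shard/Kappa3`; a shard is `⟨regime, n,
p, q, p', q', Lo, Up⟩`: `n` cells from `p/q` to `p'/q'` with integer rate sums in `[Lo, Up]`, `K =
128`, `D = 2^40`). It draws NO conclusion: only the capstone `LaiKappa3SweepCert`, which needs all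
127 shard files, does. Kernel cost of this file ≈ 560 cells × 0.3 s.
-/

namespace Summit.KontsevichZagierPeriods.Zeta5Search.Sweep

set_option maxHeartbeats 100000000 in
/-- Shard 518: 80 cells of regime B from `95/178` to `153/286`.
[cite: Lai2024BallRivoal, §4 Lemma 4.3] -/
theorem shard518 :
    Shard.check 128 (2^40)
      ⟨true, 80, 95, 178, 153, 286, 14356921387144, 17947351694718⟩ = true := by
  decide +kernel

set_option maxHeartbeats 100000000 in
/-- Shard 519: 80 cells of regime B from `153/286` to `163/304`.
[cite: Lai2024BallRivoal, §4 Lemma 4.3] -/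
theorem shard519 :
    Shard.check 128 (2^40)
      ⟨true, 80, 153, 286, 163, 304, 13902609424636, 17396141934656⟩ = true := by
  decide +kernel

set_option maxHeartbeats 100000000 in
/-- Shard 520: 80 cells of regime B from `163/304` to `201/374`.
[cite: Lai2024BallRivoal, §4 Lemma 4.3] -/
theorem shard520 :
    Shard.check 128 (2^40)
      ⟨true, 80, 163, 304, 201, 374, 14219476693879, 17809574619707⟩ = true := by
  decide +kernel

set_option maxHeartbeats 100000000 in
/-- Shard 521: 80 cells of regime B from `201/374` to `160/297`.
[cite: Lai2024BallRivoal, §4 Lemma 4.3] -/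
theorem shard521 :
    Shard.check 128 (2^40)
      ⟨true, 80, 201, 374, 160, 297, 14638333470160, 18352745267701⟩ = true := by
  decide +kernel

set_option maxHeartbeats 100000000 in
/-- Shard 522: 80 cells of regime B from `160/297` to `142/263`.
[cite: Lai2024BallRivoal, §4 Lemma 4.3] -/
theorem shard522 :
    Shard.check 128 (2^40)
      ⟨true, 80, 160, 297, 142, 263, 13666453679537, 17150269061136⟩ = true := by
  decide +kernel

set_option maxHeartbeats 100000000 in
/-- Shard 523: 80 cells of regime B from `142/263` to `650/1201`.
[cite: Lai2024BallRivoal, §4 Lemma 4.3] -/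
theorem shard523 :
    Shard.check 128 (2^40)
      ⟨true, 80, 142, 263, 650, 1201, 14643876934344, 18394757986688⟩ = true := by
  decide +kernel

set_option maxHeartbeats 100000000 in
/-- Shard 524: 80 cells of regime B from `650/1201` to `83/153`.
[cite: Lai2024BallRivoal, §4 Lemma 4.3] -/
theorem shard524 :
    Shard.check 128 (2^40)
      ⟨true, 80, 650, 1201, 83, 153, 14344900689868, 18037239354854⟩ = true := by
  decide +kernel

/-- The checked shards of this file, in order. [folklore] -/
def shards074 : List (CheckedShard 128 (2^40)) :=
  [⟨_, shard518⟩, ⟨_, shard519⟩, ⟨_, shard520⟩, ⟨_, shard521⟩, ⟨_, shard522⟩,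
    ⟨_, shard523⟩, ⟨_, shard524⟩]

end Summit.KontsevichZagierPeriods.Zeta5Search.Sweep
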